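import Mathlib
import HarnessLib
import Summits.NavierStokesRegularity.NavierStokesRegularity.Theorems.PoloidalWindowDoorLrcModEntireQ4TimeWebFunction

/-!
# Route `PoloidalWindowDoor`, item `LrcModEntire` (stmt-NavierStokesRegularity-20428), cell (Q4-curved) of the (TH) column —
# THE SPACE–TIME WEB FUNCTION OVER A CURVED BRANCH (class-free: existence, criticality, joint smoothness in `(τ, s, z)`)

Cell ns-regularity-ideate, stub-worker seat ns-poloidal-K2-p2 g18 under the LEAD of item 20428 (ns-poloidal-K2-p3 g17/g18);
`--supports stmt-NavierStokesRegularity-20428 --as helper`.  Memo `Cruxes/LrcModEntire/TOWER-CLOSES-port2g9.md` §D1/§E («B-TWPc = the curved time-web package …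
joint smoothness of `n₀(τ,s,z)` in `Γ`'s Fermi frame by the IFT brick»), LEAD 2026-08-29T23:13:57Z (v16: the NON-VERTICAL child of `stub_Q4curvedAperiodic` is
closable by the tower at base time `0` over the curved hot branch).  This file is the curved twin of port-2 g8's `…Q4TimeWebFunction` Part A: the straight
cross-sections `n ↦ F τ (s·e + n·Je + z·e₂)` are replaced by the Fermi cross-sections `n ↦ F τ (Γ s + n·JΓ′(s) + z·e₂)` of a `C^∞` planar branch `Γ`.

* `contDiffAt_curvedTimeSection`, `fderiv_curvedTimeSection_fibre`, `fderiv_fderiv_curvedTimeSection_fibre` — the space–time Fermi cross-section family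
  `((τ,s,z),n) ↦ F τ (Γ s + n·JΓ′ s + z·e₂)` is `C^m` at every point with `τ ∈ T` and its fibre derivatives are `D(F τ)(x)[JΓ′ s]`, `D²(F τ)(x)[JΓ′ s, JΓ′ s]`;
* ★ `exists_curvedTimeWebFunction` — `F` jointly smooth on the open time set `T ⊇ (−δ,δ)`, strict `JΓ′`-concavity of the cross-sections on `(−r,r)` and a unique
  strict maximiser with height-only value `R τ z` for `|τ|,|z| < δ` (the (Q4) binders in `Γ`'s frame) ⊢ a web function `n₀ : ℝ³ → ℝ` on the window carrying the
  maximiser, `∂_{JΓ′}(F τ) = 0` at the web point, and `n₀ ∈ C^m` jointly for every `m : ℕ∞` (`…CurvedWebTools.contDiffAt_criticalPoint_of_contDiffAt`).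

WHAT THIS IS NOT: not a claim about Navier–Stokes regularity; class-free calculus for research cell (Q4-curved); items 20428 / 19708 / 27893 OPEN.
-/

noncomputable section

set_option linter.dupNamespace false
set_option linter.style.longLine false

namespace Summit.NavierStokesRegularity.NavierStokesRegularity.Theorems.PoloidalWindowDoorLrcModEntireCurvedTimeWebFunction

open Set Function Filter Topology Metric
open scoped RealInnerProductSpace InnerProductSpace ContDiff
open Literature.Analysis Literature.Analysis.FluidPDE
open Summit.NavierStokesRegularity.NavierStokesRegularity.Theorems.PoloidalWindowDoorLrcModEntireSheetFlattenTools
open Summit.NavierStokesRegularity.NavierStokesRegularity.Theorems.PoloidalWindowDoorLrcModEntireRidgeGlobalBranchODE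
open Summit.NavierStokesRegularity.NavierStokesRegularity.Theorems.PoloidalWindowDoorLrcModEntireRidgeGlobalBranchFrame
open Summit.NavierStokesRegularity.NavierStokesRegularity.Theorems.PoloidalWindowDoorLrcModEntireRidgeWebImplicit
open Summit.NavierStokesRegularity.NavierStokesRegularity.Theorems.PoloidalWindowDoorLrcModEntireCurvedWebTools
open Summit.NavierStokesRegularity.NavierStokesRegularity.Theorems.PoloidalWindowDoorLrcModEntireQ4TimeWebFunction

variable {F : ℝ → EuclideanSpace ℝ (Fin 3) → ℝ} {T : Set ℝ} {Γ : ℝ → EuclideanSpace ℝ (Fin 3)}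

/-- The space–time Fermi section map `((τ,s,z),n) ↦ (τ, Γ s + n·JΓ′ s + z·e₂)` is `C^∞` for `Γ ∈ C^∞`. -/
theorem contDiff_curvedTimeSection_map (hΓ : ContDiff ℝ ∞ Γ) :
    ContDiff ℝ ∞ (fun v : (ℝ × ℝ × ℝ) × ℝ => ((v.1.1, Γ v.1.2.1 + v.2 • rotJ (deriv Γ v.1.2.1) + v.1.2.2 • e2) : ℝ × EuclideanSpace ℝ (Fin 3))) := by
  have hdΓ : ContDiff ℝ ∞ (deriv Γ) := hΓ.deriv'
  have hs : ContDiff ℝ ∞ (fun v : (ℝ × ℝ × ℝ) × ℝ => v.1.2.1) := contDiff_fst.comp (contDiff_snd.comp contDiff_fst)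
  have hz : ContDiff ℝ ∞ (fun v : (ℝ × ℝ × ℝ) × ℝ => v.1.2.2) := contDiff_snd.comp (contDiff_snd.comp contDiff_fst)
  refine (contDiff_fst.comp contDiff_fst).prodMk ((((hΓ.comp hs).add ?_).add (hz.smul contDiff_const)))
  exact contDiff_snd.smul (contDiff_rotJ.comp (hdΓ.comp hs))

/-- **The space–time Fermi cross-section family is `C^m`** at every `((τ,s,z), n)` with `τ ∈ T` (any `m`). -/
theorem contDiffAt_curvedTimeSection (hT : IsOpen T) (hF : IsSmoothSpaceTimeOn T F) (hΓ : ContDiff ℝ ∞ Γ) {m : ℕ∞} {p : ℝ × ℝ × ℝ}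
    (hp : p.1 ∈ T) (n : ℝ) :
    ContDiffAt ℝ m (fun v : (ℝ × ℝ × ℝ) × ℝ => F v.1.1 (Γ v.1.2.1 + v.2 • rotJ (deriv Γ v.1.2.1) + v.1.2.2 • e2)) (p, n) := by
  set A := fun v : (ℝ × ℝ × ℝ) × ℝ => ((v.1.1, Γ v.1.2.1 + v.2 • rotJ (deriv Γ v.1.2.1) + v.1.2.2 • e2) : ℝ × EuclideanSpace ℝ (Fin 3)) with hA
  have hfun : (fun v : (ℝ × ℝ × ℝ) × ℝ => F v.1.1 (Γ v.1.2.1 + v.2 • rotJ (deriv Γ v.1.2.1) + v.1.2.2 • e2)) = uncurry F ∘ A := by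
    funext v; rfl
  rw [hfun]
  have hFat : ContDiffAt ℝ ∞ (uncurry F) (A (p, n)) := hF.contDiffAt hT hp _
  exact (hFat.of_le (by exact WithTop.coe_le_coe.2 le_top)).comp (p, n)
    (((contDiff_curvedTimeSection_map hΓ).of_le (by exact WithTop.coe_le_coe.2 le_top)).contDiffAt)

/-- **First fibre derivative** of the space–time Fermi cross-section family: `D(F τ)(Γ s + n·JΓ′ s + z·e₂)[JΓ′ s]`. -/
theorem fderiv_curvedTimeSection_fibre (hT : IsOpen T) (hF : IsSmoothSpaceTimeOn T F) (hΓ : ContDiff ℝ ∞ Γ) {p : ℝ × ℝ × ℝ} (hp : p.1 ∈ T) (n : ℝ) :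
    fderiv ℝ (fun v : (ℝ × ℝ × ℝ) × ℝ => F v.1.1 (Γ v.1.2.1 + v.2 • rotJ (deriv Γ v.1.2.1) + v.1.2.2 • e2)) (p, n) ((0 : ℝ × ℝ × ℝ), (1 : ℝ)) =
      fderiv ℝ (F p.1) (Γ p.2.1 + n • rotJ (deriv Γ p.2.1) + p.2.2 • e2) (rotJ (deriv Γ p.2.1)) := by
  have hGd : DifferentiableAt ℝ (fun v : (ℝ × ℝ × ℝ) × ℝ => F v.1.1 (Γ v.1.2.1 + v.2 • rotJ (deriv Γ v.1.2.1) + v.1.2.2 • e2)) (p, n) :=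
    (contDiffAt_curvedTimeSection hT hF hΓ (m := 1) hp n).differentiableAt (by simp)
  have hι : HasDerivAt (fun m : ℝ => ((p, m) : (ℝ × ℝ × ℝ) × ℝ)) ((0 : ℝ × ℝ × ℝ), (1 : ℝ)) n :=
    (hasDerivAt_const n p).prodMk (hasDerivAt_id n)
  have h1 := hGd.hasFDerivAt.comp_hasDerivAt n hι
  have hFτ : ContDiff ℝ 2 (F p.1) := (hF.contDiff_slice hp).of_le (by exact WithTop.coe_le_coe.2 le_top)
  have hl : HasDerivAt (fun m : ℝ => Γ p.2.1 + m • rotJ (deriv Γ p.2.1) + p.2.2 • e2) (rotJ (deriv Γ p.2.1)) n := by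
    have h := (((hasDerivAt_id n).smul_const (rotJ (deriv Γ p.2.1))).const_add (Γ p.2.1)).add_const (p.2.2 • e2)
    simpa using h
  have h2 : HasDerivAt (fun m : ℝ => F p.1 (Γ p.2.1 + m • rotJ (deriv Γ p.2.1) + p.2.2 • e2))
      (fderiv ℝ (F p.1) (Γ p.2.1 + n • rotJ (deriv Γ p.2.1) + p.2.2 • e2) (rotJ (deriv Γ p.2.1))) n :=
    ((hFτ.differentiable (by norm_num)) _).hasFDerivAt.comp_hasDerivAt n hl
  exact h1.unique h2

/-- **Second fibre derivative** of the space–time Fermi cross-section family: `D²(F τ)(Γ s + n·JΓ′ s + z·e₂)[JΓ′ s, JΓ′ s]`. -/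
theorem fderiv_fderiv_curvedTimeSection_fibre (hT : IsOpen T) (hF : IsSmoothSpaceTimeOn T F) (hΓ : ContDiff ℝ ∞ Γ) {p : ℝ × ℝ × ℝ} (hp : p.1 ∈ T) (n : ℝ) :
    fderiv ℝ (fderiv ℝ (fun v : (ℝ × ℝ × ℝ) × ℝ => F v.1.1 (Γ v.1.2.1 + v.2 • rotJ (deriv Γ v.1.2.1) + v.1.2.2 • e2))) (p, n)
        ((0 : ℝ × ℝ × ℝ), (1 : ℝ)) ((0 : ℝ × ℝ × ℝ), (1 : ℝ)) =
      fderiv ℝ (fderiv ℝ (F p.1)) (Γ p.2.1 + n • rotJ (deriv Γ p.2.1) + p.2.2 • e2) (rotJ (deriv Γ p.2.1)) (rotJ (deriv Γ p.2.1)) := by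
  set ν : EuclideanSpace ℝ (Fin 3) := rotJ (deriv Γ p.2.1) with hν
  have hG2 : ContDiffAt ℝ 2 (fun v : (ℝ × ℝ × ℝ) × ℝ => F v.1.1 (Γ v.1.2.1 + v.2 • rotJ (deriv Γ v.1.2.1) + v.1.2.2 • e2)) (p, n) :=
    contDiffAt_curvedTimeSection hT hF hΓ hp n
  have hGd2 : DifferentiableAt ℝ (fderiv ℝ (fun v : (ℝ × ℝ × ℝ) × ℝ => F v.1.1 (Γ v.1.2.1 + v.2 • rotJ (deriv Γ v.1.2.1) + v.1.2.2 • e2))) (p, n) :=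
    (hG2.fderiv_right (m := 1) le_rfl).differentiableAt (by simp)
  have h1 := hasDerivAt_partial_fibre hGd2
  have hEq : (fun m : ℝ => fderiv ℝ (fun v : (ℝ × ℝ × ℝ) × ℝ => F v.1.1 (Γ v.1.2.1 + v.2 • rotJ (deriv Γ v.1.2.1) + v.1.2.2 • e2)) (p, m)
      ((0 : ℝ × ℝ × ℝ), (1 : ℝ))) = fun m : ℝ => fderiv ℝ (F p.1) (Γ p.2.1 + m • ν + p.2.2 • e2) ν :=
    funext fun m => fderiv_curvedTimeSection_fibre hT hF hΓ hp m
  rw [hEq] at h1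
  have hFτ : ContDiff ℝ 2 (F p.1) := (hF.contDiff_slice hp).of_le (by exact WithTop.coe_le_coe.2 le_top)
  have hDF : ∀ y, HasFDerivAt (fderiv ℝ (F p.1)) (fderiv ℝ (fderiv ℝ (F p.1)) y) y := fun y =>
    (((hFτ.fderiv_right (m := 1) (by norm_num)).differentiable one_ne_zero) y).hasFDerivAt
  have hline : HasDerivAt (fun m : ℝ => Γ p.2.1 + m • ν + p.2.2 • e2) ν n := by
    have h := (((hasDerivAt_id n).smul_const ν).const_add (Γ p.2.1)).add_const (p.2.2 • e2)
    simpa using h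
  have h2 : HasDerivAt (fun m : ℝ => fderiv ℝ (F p.1) (Γ p.2.1 + m • ν + p.2.2 • e2) ν)
      (fderiv ℝ (fderiv ℝ (F p.1)) (Γ p.2.1 + n • ν + p.2.2 • e2) ν ν) n := by
    have hc : HasDerivAt (fun m : ℝ => fderiv ℝ (F p.1) (Γ p.2.1 + m • ν + p.2.2 • e2))
        (fderiv ℝ (fderiv ℝ (F p.1)) (Γ p.2.1 + n • ν + p.2.2 • e2) ν) n := (hDF _).comp_hasDerivAt n hline
    exact hc.clm_apply (hasDerivAt_const n ν) |>.congr_deriv (by simp)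
  exact h1.unique h2

/-- ★ **THE SPACE–TIME WEB FUNCTION OVER A CURVED BRANCH.**  `F` jointly smooth on the open time set `T ⊇ (−δ,δ)`; `Γ ∈ C^∞`; strict `JΓ′`-concavity of the
Fermi cross-sections `n ↦ F τ (Γ s + n·JΓ′ s + z·e₂)` on `(−r,r)` for `|τ|,|z| < δ`; a unique strict maximiser in `(−r,r)` with height-only value `R τ z`.  Then
there is `n₀ : ℝ × ℝ × ℝ → ℝ` on the window carrying the maximiser, with `∂_{JΓ′}(F τ) = 0` at the web point, `C^m` jointly in `(τ,s,z)` for every `m : ℕ∞`. -/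
theorem exists_curvedTimeWebFunction (hT : IsOpen T) (hF : IsSmoothSpaceTimeOn T F) (hΓ : ContDiff ℝ ∞ Γ) {δ r : ℝ} (hδT : Ioo (-δ) δ ⊆ T)
    (hconc : ∀ τ z : ℝ, |τ| < δ → |z| < δ → ∀ s : ℝ, ∀ n ∈ Ioo (-r) r,
      fderiv ℝ (fderiv ℝ (F τ)) (Γ s + n • rotJ (deriv Γ s) + z • e2) (rotJ (deriv Γ s)) (rotJ (deriv Γ s)) < 0)
    {R : ℝ → ℝ → ℝ}
    (hS : ∀ τ z : ℝ, |τ| < δ → |z| < δ → ∀ s : ℝ, ∃ n₀ ∈ Ioo (-r) r, F τ (Γ s + n₀ • rotJ (deriv Γ s) + z • e2) = R τ z ∧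
      ∀ n ∈ Icc (-r) r, n ≠ n₀ → F τ (Γ s + n • rotJ (deriv Γ s) + z • e2) < R τ z) :
    ∃ n₀ : ℝ × ℝ × ℝ → ℝ,
      (∀ q : ℝ × ℝ × ℝ, |q.1| < δ → |q.2.2| < δ → n₀ q ∈ Ioo (-r) r ∧ F q.1 (Γ q.2.1 + n₀ q • rotJ (deriv Γ q.2.1) + q.2.2 • e2) = R q.1 q.2.2 ∧
        ∀ n ∈ Icc (-r) r, n ≠ n₀ q → F q.1 (Γ q.2.1 + n • rotJ (deriv Γ q.2.1) + q.2.2 • e2) < R q.1 q.2.2) ∧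
      (∀ q : ℝ × ℝ × ℝ, |q.1| < δ → |q.2.2| < δ → fderiv ℝ (F q.1) (Γ q.2.1 + n₀ q • rotJ (deriv Γ q.2.1) + q.2.2 • e2) (rotJ (deriv Γ q.2.1)) = 0) ∧
      (∀ m : ℕ∞, ∀ q : ℝ × ℝ × ℝ, |q.1| < δ → |q.2.2| < δ → ContDiffAt ℝ m n₀ q) := by
  classical
  set V : Set (ℝ × ℝ × ℝ) := {q | |q.1| < δ ∧ |q.2.2| < δ} with hV
  have hVo : IsOpen V := (isOpen_lt (continuous_fst.abs) continuous_const).inter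
    (isOpen_lt ((continuous_snd.comp continuous_snd).abs) continuous_const)
  set n₀ : ℝ × ℝ × ℝ → ℝ := fun q => if h : |q.1| < δ ∧ |q.2.2| < δ then Classical.choose (hS q.1 q.2.2 h.1 h.2 q.2.1) else 0 with hn₀
  have hspec : ∀ q : ℝ × ℝ × ℝ, |q.1| < δ → |q.2.2| < δ → n₀ q ∈ Ioo (-r) r ∧ F q.1 (Γ q.2.1 + n₀ q • rotJ (deriv Γ q.2.1) + q.2.2 • e2) = R q.1 q.2.2 ∧
      ∀ n ∈ Icc (-r) r, n ≠ n₀ q → F q.1 (Γ q.2.1 + n • rotJ (deriv Γ q.2.1) + q.2.2 • e2) < R q.1 q.2.2 := by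
    intro q h1 h2
    have hq : n₀ q = Classical.choose (hS q.1 q.2.2 h1 h2 q.2.1) := by rw [hn₀]; simp [h1, h2]
    obtain ⟨hin, hval, huniq⟩ := Classical.choose_spec (hS q.1 q.2.2 h1 h2 q.2.1)
    rw [hq]; exact ⟨hin, hval, huniq⟩
  have hT' : ∀ q ∈ V, q.1 ∈ T := fun q hq => hδT ⟨(abs_lt.1 hq.1).1, (abs_lt.1 hq.1).2⟩
  -- criticality: interior maximum of the Fermi cross-section
  have hcritF : ∀ q ∈ V, fderiv ℝ (F q.1) (Γ q.2.1 + n₀ q • rotJ (deriv Γ q.2.1) + q.2.2 • e2) (rotJ (deriv Γ q.2.1)) = 0 := by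
    intro q hq
    obtain ⟨hin, hval, huniq⟩ := hspec q hq.1 hq.2
    have hloc : IsLocalMax (fun m : ℝ => F q.1 (Γ q.2.1 + m • rotJ (deriv Γ q.2.1) + q.2.2 • e2)) (n₀ q) := by
      have hI : Icc (-r) r ∈ 𝓝 (n₀ q) := Icc_mem_nhds hin.1 hin.2
      refine Filter.eventually_of_mem hI fun m hm => ?_
      show F q.1 (Γ q.2.1 + m • rotJ (deriv Γ q.2.1) + q.2.2 • e2) ≤ F q.1 (Γ q.2.1 + n₀ q • rotJ (deriv Γ q.2.1) + q.2.2 • e2)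
      by_cases hmn : m = n₀ q
      · rw [hmn]
      · rw [hval]; exact (huniq m hm hmn).le
    have hd := hloc.deriv_eq_zero
    have hFτ : ContDiff ℝ 2 (F q.1) := (hF.contDiff_slice (hT' q hq)).of_le (by exact WithTop.coe_le_coe.2 le_top)
    have hl : HasDerivAt (fun m : ℝ => Γ q.2.1 + m • rotJ (deriv Γ q.2.1) + q.2.2 • e2) (rotJ (deriv Γ q.2.1)) (n₀ q) := by
      have h := (((hasDerivAt_id (n₀ q)).smul_const (rotJ (deriv Γ q.2.1))).const_add (Γ q.2.1)).add_const (q.2.2 • e2)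
      simpa using h
    have h2 : HasDerivAt (fun m : ℝ => F q.1 (Γ q.2.1 + m • rotJ (deriv Γ q.2.1) + q.2.2 • e2))
        (fderiv ℝ (F q.1) (Γ q.2.1 + n₀ q • rotJ (deriv Γ q.2.1) + q.2.2 • e2) (rotJ (deriv Γ q.2.1))) (n₀ q) :=
      ((hFτ.differentiable (by norm_num)) _).hasFDerivAt.comp_hasDerivAt (n₀ q) hl
    rw [← h2.deriv]; exact hd
  refine ⟨n₀, hspec, fun q h1 h2 => hcritF q ⟨h1, h2⟩, fun m q h1 h2 => ?_⟩
  -- smoothness: the `C^m` implicit function theorem at a non-degenerate critical point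
  have hq : q ∈ V := ⟨h1, h2⟩
  have hG : ∀ p ∈ V, ∀ n' ∈ Ioo (-r) r,
      ContDiffAt ℝ (m + 1) (fun v : (ℝ × ℝ × ℝ) × ℝ => F v.1.1 (Γ v.1.2.1 + v.2 • rotJ (deriv Γ v.1.2.1) + v.1.2.2 • e2)) (p, n') :=
    fun p hp n' _ => contDiffAt_curvedTimeSection hT hF hΓ (hT' p hp) n'
  have hconcG : ∀ p ∈ V, ∀ n' ∈ Ioo (-r) r,
      fderiv ℝ (fderiv ℝ (fun v : (ℝ × ℝ × ℝ) × ℝ => F v.1.1 (Γ v.1.2.1 + v.2 • rotJ (deriv Γ v.1.2.1) + v.1.2.2 • e2))) (p, n')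
        ((0 : ℝ × ℝ × ℝ), (1 : ℝ)) ((0 : ℝ × ℝ × ℝ), (1 : ℝ)) < 0 := by
    intro p hp n' hn'
    rw [fderiv_fderiv_curvedTimeSection_fibre hT hF hΓ (hT' p hp) n']
    exact hconc p.1 p.2.2 hp.1 hp.2 p.2.1 n' hn'
  have hn₀V : ∀ p ∈ V, n₀ p ∈ Ioo (-r) r := fun p hp => (hspec p hp.1 hp.2).1
  have hcrit : ∀ p ∈ V, fderiv ℝ (fun v : (ℝ × ℝ × ℝ) × ℝ => F v.1.1 (Γ v.1.2.1 + v.2 • rotJ (deriv Γ v.1.2.1) + v.1.2.2 • e2)) (p, n₀ p)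
      ((0 : ℝ × ℝ × ℝ), (1 : ℝ)) = 0 := by
    intro p hp
    rw [fderiv_curvedTimeSection_fibre hT hF hΓ (hT' p hp) (n₀ p)]
    exact hcritF p hp
  have hm0 : (m : ℕ∞ω) ≠ 0 ∨ (m : ℕ∞ω) = 0 := by by_cases h : (m : ℕ∞ω) = 0 <;> simp [h]
  rcases hm0 with hm0 | hm0
  · exact contDiffAt_criticalPoint_of_contDiffAt hVo hm0 le_rfl hG hconcG hn₀V hcrit hq
  · have h1' : ContDiffAt ℝ 1 n₀ q := by
      have hG1 : ∀ p ∈ V, ∀ n' ∈ Ioo (-r) r,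
          ContDiffAt ℝ ((1 : ℕ∞) + 1) (fun v : (ℝ × ℝ × ℝ) × ℝ => F v.1.1 (Γ v.1.2.1 + v.2 • rotJ (deriv Γ v.1.2.1) + v.1.2.2 • e2)) (p, n') :=
        fun p hp n' _ => contDiffAt_curvedTimeSection hT hF hΓ (hT' p hp) n'
      exact contDiffAt_criticalPoint_of_contDiffAt hVo (by simp) le_rfl hG1 hconcG hn₀V hcrit hq
    rw [hm0]
    exact h1'.of_le (by simp)

end Summit.NavierStokesRegularity.NavierStokesRegularity.Theorems.PoloidalWindowDoorLrcModEntireCurvedTimeWebFunction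

end
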